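import Mathlib
import HarnessLib
import Summits.Ventures.LatticeQCDFlow.Exactness.SphereExpMapLocalChart
import Literature.Analysis.Fourier.SincSmooth

/-!
# The flat side of the exponential chart: `expBall n 1 y = cos‖y‖·e₀ + (0, sinc‖y‖·y)`, and `y ↦ sinc‖y‖·y` is an approximate identity near the origin

HONEST FRAMING: exact (Metropolis-corrected) sampling algorithms for lattice gauge theory;
figures of merit are autocorrelation/cost numbers at stated couplings and volumes; no
continuum-physics claim.

Venture `LatticeQCDFlow` (cell pub-lqcd), topic `Exactness`, FANOUT row 9 (eng-latcore; Step 3 of the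
roadmap to multi-step HMC on the `cpn_2d` sphere family, HOME/eng-latcore/HANDOFF.md GEN-19).  NEW WORK of
the cell over Mathlib (`Real.sinc`, `ContDiffAt.exists_lipschitzOnWith`), the Literature's
`Analysis/Fourier/SincSmooth.lean` (`contDiff_sinc`, used by name) and the tree (gen-16's `SphereExpMapChart.lean` /
row 7's `SphereAxisCoordinates.lean`: `expBall`, `latitudePt`, `polarAxis`, `equatorEmbed`, `dirSphere`;
`SphereExpMapLocalChart.lean`: the local chart comparison); nothing is cited as a fact; no number.

THE POINT.  The local chart comparison `σ|_{cap r} ≤ t^{n+1}•(Leb|_{ball(r/t)}).map (expBall n t)` (previous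
file) is stated through the EXPONENTIAL map, while the multi-step position readout is LINEAR in the
tangent coordinates (orthogonal projection onto the equatorial hyperplane).  The two differ by the radial
map `κ(y) = sinc‖y‖ · y` (the equatorial part of `expBall n 1 y`), which is an approximate identity near
`0`: for every `η > 0` there is `ρ > 0` with `‖κ y − κ y' − (y − y')‖ ≤ η‖y − y'‖` on `‖y‖, ‖y'‖ ≤ ρ` —
so `κ` composes with the approximate dilation of the trajectory and ONE application of
`LocalDilationPushforward.addHaar_inter_ball_le_of_approxOn` covers both.

* §1 `exists_sinc_lipschitz_near_zero` (from the Literature's `Analysis/Fourier/SincSmooth.contDiff_sinc`,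
  used by name), `exists_sinc_near_one` (continuity).
* §2 `flatExp n y = sinc‖y‖ • y`, **`coe_expBall_one`** (`expBall n 1 y = cos‖y‖ • e₀ + equatorEmbed (flatExp y)`),
  **`exists_flatExp_defect`** (the `η`-defect on a ball).

NOT CLAIMED: the composition with the trajectory readout and the position law (roadmap Steps 2–4), rates.
-/

noncomputable section

namespace Summit.Ventures.LatticeQCDFlow.Exactness

open MeasureTheory Measure Metric Set Real Filter Topology
open scoped ENNReal InnerProductSpace NNReal

/-! ## §1 `sinc` near the origin -/

/-- A Lipschitz constant for `sinc` near `0`. -/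
theorem exists_sinc_lipschitz_near_zero :
    ∃ L : ℝ≥0, ∃ ρ : ℝ, 0 < ρ ∧ ∀ s ∈ closedBall (0 : ℝ) ρ, ∀ s' ∈ closedBall (0 : ℝ) ρ,
      |Real.sinc s - Real.sinc s'| ≤ L * |s - s'| := by
  have h1 : ContDiff ℝ 1 Real.sinc :=
    Literature.Analysis.Fourier.contDiff_sinc.of_le (by exact_mod_cast le_top)
  obtain ⟨L, t, ht, hL⟩ := h1.contDiffAt.exists_lipschitzOnWith (x := (0 : ℝ))
  obtain ⟨ρ, hρ, hball⟩ := Metric.mem_nhds_iff.1 ht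
  refine ⟨L, ρ / 2, by positivity, fun s hs s' hs' => ?_⟩
  have hs2 : s ∈ t := hball (mem_ball.2 (lt_of_le_of_lt (mem_closedBall.1 hs) (by linarith)))
  have hs2' : s' ∈ t := hball (mem_ball.2 (lt_of_le_of_lt (mem_closedBall.1 hs') (by linarith)))
  have h := hL.dist_le_mul s hs2 s' hs2'
  rwa [Real.dist_eq, Real.dist_eq] at h

/-- `sinc` is near `1` near `0`. -/
theorem exists_sinc_near_one {η : ℝ} (hη : 0 < η) :
    ∃ ρ : ℝ, 0 < ρ ∧ ∀ s : ℝ, |s| ≤ ρ → |Real.sinc s - 1| ≤ η := by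
  have hc : ContinuousAt Real.sinc 0 := Real.continuous_sinc.continuousAt
  obtain ⟨δ, hδ, h⟩ := Metric.continuousAt_iff.1 hc η hη
  refine ⟨δ / 2, by positivity, fun s hs => ?_⟩
  have h' := h (x := s) (by rw [Real.dist_eq, sub_zero]; linarith)
  rw [Real.dist_eq, Real.sinc_zero] at h'
  exact h'.le

/-! ## §2 The equatorial part of the exponential map -/

section Flat

variable (n : ℕ)

/-- **The flat form of the exponential chart**: `κ(y) = sinc‖y‖ · y` (`= (sin‖y‖/‖y‖) y`, `= 0` at `0`). -/
def flatExp (y : EuclideanSpace ℝ (Fin (n + 1))) : EuclideanSpace ℝ (Fin (n + 1)) := Real.sinc ‖y‖ • y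

/-- **`expBall n 1 y = cos‖y‖ • e₀ + (0, κ y)`.** -/
theorem coe_expBall_one (y : EuclideanSpace ℝ (Fin (n + 1))) :
    (expBall n 1 y : EuclideanSpace ℝ (Fin (n + 2))) = Real.cos ‖y‖ • polarAxis n + equatorEmbed n (flatExp n y) := by
  rw [expBall, coe_latitudePt, mul_one, flatExp, map_smul]
  congr 1
  by_cases hy : y = 0
  · subst hy; simp
  · rw [dirSphere_coe hy, map_smul, smul_smul, Real.sinc_of_ne_zero (norm_ne_zero_iff.2 hy), div_eq_mul_inv]

/-- **The flat exponential chart is an approximate identity near the origin**: for every `η > 0` there is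
`ρ > 0` with `‖κ y − κ y' − (y − y')‖ ≤ η ‖y − y'‖` for `‖y‖, ‖y'‖ ≤ ρ`. -/
theorem exists_flatExp_defect {η : ℝ} (hη : 0 < η) :
    ∃ ρ : ℝ, 0 < ρ ∧ ∀ y y' : EuclideanSpace ℝ (Fin (n + 1)), ‖y‖ ≤ ρ → ‖y'‖ ≤ ρ →
      ‖flatExp n y - flatExp n y' - (y - y')‖ ≤ η * ‖y - y'‖ := by
  obtain ⟨L, ρ₁, hρ₁, hL⟩ := exists_sinc_lipschitz_near_zero
  obtain ⟨ρ₂, hρ₂, h1⟩ := exists_sinc_near_one (η := η / 2) (by positivity)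
  set ρ : ℝ := min ρ₁ (min ρ₂ (η / (2 * ((L : ℝ) + 1)))) with hρ
  have hρpos : 0 < ρ := lt_min hρ₁ (lt_min hρ₂ (by positivity))
  refine ⟨ρ, hρpos, fun y y' hy hy' => ?_⟩
  have hyρ₁ : ‖y‖ ≤ ρ₁ := hy.trans (min_le_left _ _)
  have hy'ρ₁ : ‖y'‖ ≤ ρ₁ := hy'.trans (min_le_left _ _)
  have hyρ₂ : ‖y‖ ≤ ρ₂ := hy.trans ((min_le_right _ _).trans (min_le_left _ _))
  have hρ₃ : ρ ≤ η / (2 * ((L : ℝ) + 1)) := (min_le_right _ _).trans (min_le_right _ _)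
  -- decomposition
  have hdec : flatExp n y - flatExp n y' - (y - y') =
      (Real.sinc ‖y‖ - 1) • (y - y') + (Real.sinc ‖y‖ - Real.sinc ‖y'‖) • y' := by
    simp only [flatExp, sub_smul, smul_sub, one_smul]
    abel
  rw [hdec]
  have hA : ‖(Real.sinc ‖y‖ - 1) • (y - y')‖ ≤ η / 2 * ‖y - y'‖ := by
    rw [norm_smul, Real.norm_eq_abs]
    exact mul_le_mul_of_nonneg_right (h1 _ (by rw [abs_of_nonneg (norm_nonneg _)]; exact hyρ₂)) (norm_nonneg _)
  have hB : ‖(Real.sinc ‖y‖ - Real.sinc ‖y'‖) • y'‖ ≤ η / 2 * ‖y - y'‖ := by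
    rw [norm_smul, Real.norm_eq_abs]
    have hs := hL ‖y‖ (by rw [mem_closedBall, dist_zero_right, Real.norm_eq_abs, abs_of_nonneg (norm_nonneg _)]; exact hyρ₁)
      ‖y'‖ (by rw [mem_closedBall, dist_zero_right, Real.norm_eq_abs, abs_of_nonneg (norm_nonneg _)]; exact hy'ρ₁)
    have hnn : |‖y‖ - ‖y'‖| ≤ ‖y - y'‖ := abs_norm_sub_norm_le y y'
    have hL0 : (0 : ℝ) ≤ L := L.2
    calc |Real.sinc ‖y‖ - Real.sinc ‖y'‖| * ‖y'‖ ≤ (L * ‖y - y'‖) * ρ :=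
          mul_le_mul (hs.trans (mul_le_mul_of_nonneg_left hnn hL0)) hy' (norm_nonneg _) (by positivity)
      _ = (L * ρ) * ‖y - y'‖ := by ring
      _ ≤ η / 2 * ‖y - y'‖ := by
          refine mul_le_mul_of_nonneg_right ?_ (norm_nonneg _)
          calc (L : ℝ) * ρ ≤ L * (η / (2 * (L + 1))) := mul_le_mul_of_nonneg_left hρ₃ hL0
            _ ≤ η / 2 := by
                rw [mul_div_assoc', div_le_div_iff₀ (by positivity) (by positivity)]
                nlinarith
  calc ‖(Real.sinc ‖y‖ - 1) • (y - y') + (Real.sinc ‖y‖ - Real.sinc ‖y'‖) • y'‖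
      ≤ η / 2 * ‖y - y'‖ + η / 2 * ‖y - y'‖ := (norm_add_le _ _).trans (add_le_add hA hB)
    _ = η * ‖y - y'‖ := by ring

end Flat

end Summit.Ventures.LatticeQCDFlow.Exactness
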